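/-
Copyright: lit-balaban cell, Phase-2 proof seat p24 (gen 23).  Released under Apache 2.0 license as described in the
file LICENSE.
-/
import Literature.MathematicalPhysics.QuantumFieldTheory.Balaban1983to89.B4Eq243TransformSummable

/-!
# `Balaban1983to89.B4Eq245Aliasing` — [Balaban1983RegularityDecay] p. 584–585, **(2.44) ⇒ (2.45)**: the ALIASING
# IDENTITY of the block-averaging projection `Q_j^*Q_j` under the Fourier transform (2.43), for a GENERAL summable `φ₀`

statement-level skeleton of published theorems with citation tags; proofs where landed; nothing here is a claim about
the Yang–Mills mass gap

CITATION HEADER.  T. Bałaban, *Regularity and decay of lattice Green's functions*, Commun. Math. Phys. **89** (1983)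
571–597, doi:10.1007/bf01214744 [Balaban1983RegularityDecay] (cell paper B4; held text
`paper:balaban1983-cmp89-regularity-decay`, journal page = PDF page + 570), p. 584–585 [PDF 14–15]; renders
`pub-balaban/b2b-balaban-ref1/pages/1983-cmp89-regularity-decay/1983-cmp89-regularity-decay-p014-x2.png`, `…-p015-x2.png`
read as images by this seat (unit `lit-balaban-p24` gen 23; HOME `run/shared/lean/pub/lit-balaban/`; SKELETON row
**B4.Eq2.43** = displays (2.43)–(2.48); this file is member 3 of the three owed members named in the B4 owner's audit
`lit-balaban-r01/AUDIT-B4-DEF-g42.md` §Plan — «the ALIASING identity for `blockAvg` (Q^*Q)» and «(2.45) for a general φ₀»;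
member 1 = (2.43) is `B4Eq243TransformSummable`, member 2 = the fibrewise solution (2.46) is r01's `B4Eq246Fibre`).

WHAT IS PRINTED (p. 584, verbatim).  «We apply it to the basic equation
  (−Δ^ξ + m_j² + a_jQ_j^*Q_j)φ₀ = f.   (2.44)
Defining the propagator G_j, φ₀ = G_jf, we get
  Δ^ξ(p)φ̃₀(p) + a_ju_j(p) Σ_{l′} \overline{u_j(p′+l′)} φ̃₀(p′+l′) = f̃(p),
  u_j(p) = Π_{μ=1}^d (e^{−ip_μ} − 1)/((e^{−iξp_μ} − 1)/ξ),   Δ^ξ(p) = Σ_{μ=1}^d |(e^{−iξp_μ} − 1)/ξ|² + m_j²,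
  p′ ∈ [−π,π[^d,  l′ = (l′₁,…,l′_d),  l′_μ = 2πm′_μ,  m′_μ is an integer,  −(L^j−1)/2 ≤ m′_μ ≤ (L^j−1)/2 for L odd,
  −L^j/2 ≤ m′_μ < L^j/2 for L even.   (2.45)»
and p. 585: «To calculate G_jQ_j^*, we take f = Q_j^*g in this formula, g is a function on the unit lattice,
f̃(p) = u_j(p)g̃(p′), g̃(p′) = Σ_y e^{−ip′·y}g(y), and we get (2.47)».  (`p = p′ + l`; `(Q_jφ)(y) = Σ_{x∈B(y)}ξ^dφ(x)`,
`(Q_j^*g)(x) = g(y(x))`, `Q_j^*Q_j =` the tree's `B4Green244.blockAvg n`, (1.4)–(1.5) p. 572 at `A = 0`.)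

WHAT THIS MODULE PROVES (kernel-checked; 3 small definitions WITH BODIES + theorems; 0 `sorry`; 0 `Prop` facts; axioms
standard).  Dictionary of `B4Green244`/`B4Eq243TransformSummable` (fine point `z ∈ ℤ^d`, block label `y = ⌊z/n⌋ = coarse n z`,
offset `τ = z mod n`, reduced momentum `P = p′ ∈ ℂ^d`, fibre momenta `p′ + l = shift n k P`, `u_j(p′+l) = V n k P`,
`φ̃ = ftSum n φ`):
* `blockEquiv n : ℤ^d × (Fin d → Fin n) ≃ ℤ^d`, `(y, τ) ↦ ny + τ`, and **`tsum_eq_tsum_blocks`** — a summable series over the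
  fine lattice is the series over block labels of the finite block sums (the bookkeeping behind every `Σ_x = Σ_y Σ_{x∈B(y)}`);
* `uft g P` = print's unit-lattice transform **`g̃(p′) = Σ_y e^{−ip′·y} g(y)` WITH BODY** (= `ftSum 1 g`, `uft_eq_ftSum_one`) and
  `Qavg n φ` = `(Q_jφ)(y) = ξ^d Σ_{x∈B(y)} φ(x)` WITH BODY (`blockAvg n φ = Qavg n φ ∘ coarse n`, `blockAvg_eq_Qavg_coarse`);
* `Vb n k P = Π_ν vb_n(k_ν; P_ν)` = the continuation of **`\overline{u_j(p′+l′)}`**, with **`Vb_ofRealVec`: `Vb = conj V` on real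
  momenta** (so on the zone it IS print's complex conjugate) and the ū-twin of `B4Green244.sum_PhZ_V`:
  **`sum_PhZ_neg_Vb`: `Σ_{l′} e^{−i(p′+l′)·x} ū_j(p′+l′) = e^{−ip′·y(x)}`**;
* **`ftSum_blockConst`** — p. 585 «f = Q_j^*g ⇒ f̃(p) = u_j(p) g̃(p′)»: `ftSum n (g ∘ coarse n) (shift n k P) = V n k P · uft g P`;
* **`uft_Qavg` — THE ALIASING IDENTITY**: `(Q_jφ)~(p′) = Σ_{l′} ū_j(p′+l′) φ̃(p′+l′)`;
* **`ftSum_blockAvg`** — both together: `(Q_j^*Q_jφ)~(p′+l) = u_j(p′+l) Σ_{l′} ū_j(p′+l′) φ̃(p′+l′)` — THE SECOND SUMMAND OF (2.45);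
* **`eq245_of_eq244` — (2.44) ⇒ (2.45) AS PRINTED**: for `φ₀, f ∈ ℓ¹(ℤ^d)` with `(−Δ^ξ + m² + aQ^*Q)φ₀ = f` on the fine
  lattice (`B4Green244.opD`), for every real reduced momentum `p′` and every shift `l = 2πk`:
  `Δ^ξ(p′+l)φ̃₀(p′+l) + a u_j(p′+l) Σ_{l′} \overline{u_j(p′+l′)} φ̃₀(p′+l′) = f̃(p′+l)`, the sum carrying `conj (V n k′ ·)`
  — i.e. EXACTLY the fibre hypothesis `Δ k·φ k + a·u k·Σ_{k′} conj(u k′)·φ k′ = f k` of r01's `B4Eq246Fibre.sol246_unique`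
  (`Δ k = DeltaXi n m² (shift n k (ofRealVec p′))`, `u k = V n k (ofRealVec p′)`, `φ k = ftSum n φ₀ (shift n k (ofRealVec p′))`,
  `f k = ftSum n f (shift n k (ofRealVec p′))`), whence (2.46) for every summable solution — the synthesis is a separate
  file once `B4Eq246Fibre` is in the tree.

DICTIONARY / HONEST SCOPE.  (i) All algebraic identities (§3–§5) hold at COMPLEX reduced momentum `P` under the explicit
hypothesis that the series (2.43) of `φ` converges at `P` (hence at every fibre point `shift n k P`, `summable_ftTerm_shift`):
all `P` for finitely supported `φ`, all real `P` for `φ ∈ ℓ¹`; `eq245_of_eq244` is stated in the `ℓ¹`/real-momentum setting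
of (2.45) («p′ ∈ [−π,π[^d»; in fact every real `p′`, by periodicity).  (ii) Representatives `k_μ ∈ {0,…,n−1}` of the shifts
instead of the printed symmetric range of `m′_μ` (every fibre quantity is `2πn`-periodic: `B4Eq243TransformSummable.ftSum_periodic`,
`B4StripSums.shift_decomp`).  (iii) Scalar `φ` (print's `R^N`-valued fields componentwise; (2.44) is colour-diagonal at `A = 0`).
(iv) NOT here: (2.46)–(2.48) (r01's `B4Eq246Fibre`, `B4Green244.green244`/`K_eq`), uniqueness of `ℓ¹` solutions of (2.44)
(the synthesis file).  Value = kernel certificate of the passage (2.44) ⇒ (2.45) of [B4] §2; NOT summit progress.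
-/

namespace Literature.MathematicalPhysics.QuantumFieldTheory.Balaban1983to89.B4Eq245Aliasing

open Complex Finset MeasureTheory
open Literature.MathematicalPhysics.QuantumFieldTheory.Balaban1983to89.B4Strip
open Literature.MathematicalPhysics.QuantumFieldTheory.Balaban1983to89.B4ContourShift
open Literature.MathematicalPhysics.QuantumFieldTheory.Balaban1983to89.B4StripSums
open Literature.MathematicalPhysics.QuantumFieldTheory.Balaban1983to89.B4StripSumsHolder
open Literature.MathematicalPhysics.QuantumFieldTheory.Balaban1983to89.B4Green244
open Literature.MathematicalPhysics.QuantumFieldTheory.Balaban1983to89.B4Eq243Transform (phaseC_neg)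
open Literature.MathematicalPhysics.QuantumFieldTheory.Balaban1983to89.B4Eq243TransformSummable
open scoped Real ComplexConjugate

noncomputable section

variable {d : ℕ}

/-! ### §1 Blocks: `ℤ^d = ⋃_y B(y)`, the series over the fine lattice as a series of block sums -/

/-- `(n x + j) mod n = j` for an offset `j ∈ {0,…,n−1}^d`. [folklore] -/
private theorem offset_of_finePt (n : ℕ) [NeZero n] (x : Fin d → ℤ) (j : Fin d → Fin n) : offset n (finePt n x j) = j := by
  funext ν
  apply Fin.ext
  simp only [offset, finePt]
  have hn : (0 : ℤ) < n := by exact_mod_cast Nat.pos_of_ne_zero (NeZero.ne n)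
  rw [add_comm, Int.add_mul_emod_self_left, Int.emod_eq_of_lt (by positivity) (by exact_mod_cast (j ν).isLt)]
  simp

/-- THE BLOCK DECOMPOSITION OF THE FINE LATTICE as an equivalence: `(y, τ) ↦ n y + τ` with inverse `z ↦ (⌊z/n⌋, z mod n)`
(`ℤ^d = ⋃_{y∈ℤ^d} B(y)`, `B(y) = {ny + τ : τ ∈ {0,…,n−1}^d}`). [folklore] -/
def blockEquiv (n : ℕ) [NeZero n] : (Fin d → ℤ) × (Fin d → Fin n) ≃ (Fin d → ℤ) where
  toFun yτ := finePt n yτ.1 yτ.2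
  invFun z := (coarse n z, offset n z)
  left_inv yτ := by
    rcases yτ with ⟨y, τ⟩
    simp only [coarse_finePt, offset_of_finePt]
  right_inv z := finePt_coarse_offset n z

/-- **`Σ_x = Σ_y Σ_{x ∈ B(y)}`** for an (absolutely) summable series on the fine lattice: `Σ'_z F(z) = Σ'_y Σ_τ F(ny + τ)`.
[folklore] -/
private theorem tsum_eq_tsum_blocks (n : ℕ) [NeZero n] {F : (Fin d → ℤ) → ℂ} (hF : Summable F) :
    ∑' z, F z = ∑' y : Fin d → ℤ, ∑ τ : Fin d → Fin n, F (finePt n y τ) := by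
  rw [← (blockEquiv n).tsum_eq F]
  have hF' : Summable (F ∘ blockEquiv n) := (blockEquiv n).summable_iff.mpr hF
  rw [show (fun c : (Fin d → ℤ) × (Fin d → Fin n) => F (blockEquiv n c)) = F ∘ blockEquiv n from rfl,
    hF'.tsum_prod]
  refine tsum_congr fun y => ?_
  rw [tsum_fintype]
  rfl

/-! ### §2 Print's unit-lattice transform `g̃` and block average `Q_j`, WITH BODIES -/

/-- **`g̃(p′) = Σ_y e^{−ip′·y} g(y)`** — the Fourier transform of a function on the UNIT lattice `ℤ^d` (p. 585), continued to
complex `p′`; a `tsum` (finite sum for finitely supported `g`, absolutely convergent on real `p′` for `g ∈ ℓ¹`).  It is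
(2.43) at `ξ = 1`: `uft_eq_ftSum_one`. [cite: Balaban1983RegularityDecay, (2.47) p.585] -/
def uft (g : (Fin d → ℤ) → ℂ) (P : Fin d → ℂ) : ℂ := ∑' y : Fin d → ℤ, cexp (-(I * phaseC P y)) * g y

/-- `g̃ = ftSum 1 g` (the fine-lattice transform (2.43) at `n = 1`, `ξ = 1`). [cite: Balaban1983RegularityDecay, (2.43) p.584, (2.47) p.585] -/
theorem uft_eq_ftSum_one (g : (Fin d → ℤ) → ℂ) (P : Fin d → ℂ) : uft g P = ftSum 1 g P := by
  rw [uft, ftSum_def]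
  simp

/-- **`(Q_jφ)(y) = Σ_{x∈B(y)} ξ^d φ(x)`** — the block average onto the unit lattice ((1.4) p. 572 at `A = 0`), WITH BODY:
`Qavg n φ y = n^{−d} Σ_τ φ(ny + τ)`. [cite: Balaban1983RegularityDecay, (1.4) p.572] -/
def Qavg (n : ℕ) (φ : (Fin d → ℤ) → ℂ) (y : Fin d → ℤ) : ℂ := ((n : ℂ) ^ d)⁻¹ * ∑ τ : Fin d → Fin n, φ (finePt n y τ)

/-- `Q_j^*Q_j = Q_j^* ∘ Q_j`: the tree's `blockAvg` is `Qavg` read at the block label, `(Q^*Qφ)(z) = (Qφ)(⌊z/n⌋)`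
((1.5) p. 572, `(Q^*g)(x) = g(y(x))`). [cite: Balaban1983RegularityDecay, (1.4)–(1.5) p.572] -/
theorem blockAvg_eq_Qavg_coarse (n : ℕ) (φ : (Fin d → ℤ) → ℂ) (z : Fin d → ℤ) :
    blockAvg n φ z = Qavg n φ (coarse n z) := rfl

/-! ### §3 The conjugate fibre factor `ū_j(p′+l′)` and the ū-twin of `Q_jQ_j^* = 1` -/

/-- **`ū_j(p′ + 2πk)` continued**: `Vb n k P = Π_ν vb_n(k_ν; P_ν)`, `vb_n(j; ζ) = (1/n)Σ_{s<n} e^{i(ζ+2πj)s/n}`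
(`B4Green244.vb`); on real momenta it is the complex conjugate of `V n k P = u_j(p′+2πk)` (`Vb_ofRealVec`).
[cite: Balaban1983RegularityDecay, (2.45) p.584] -/
def Vb (n : ℕ) (k : Fin d → Fin n) (P : Fin d → ℂ) : ℂ := ∏ ν, vb n (k ν : ℕ) (P ν)

/-- one coordinate: on a real momentum `vb` is the conjugate of `v`. [folklore] -/
private theorem vb_ofReal (n j : ℕ) (x : ℝ) : vb n j (x : ℂ) = conj (v n j (x : ℂ)) := by
  unfold vb v w
  rw [map_mul, map_inv₀, Complex.conj_natCast, map_sum]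
  congr 1
  refine Finset.sum_congr rfl fun s _ => ?_
  rw [map_pow, ← Complex.exp_conj, ← Complex.exp_nat_mul, ef]
  congr 1
  simp only [map_neg, map_div₀, map_mul, Complex.conj_I, Complex.conj_ofReal, map_add, map_ofNat,
    Complex.conj_natCast]
  ring

/-- **`ū = conj u` ON REAL MOMENTA**: `Vb n k (ofRealVec p) = conj (V n k (ofRealVec p))` — so in (2.45) at real `p′` the factor
`Vb` IS print's `\overline{u_j(p′+l′)}`. [cite: Balaban1983RegularityDecay, (2.45) p.584] -/
theorem Vb_ofRealVec (n : ℕ) (k : Fin d → Fin n) (p : Fin d → ℝ) :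
    Vb n k (ofRealVec p) = conj (V n k (ofRealVec p)) := by
  unfold Vb V
  rw [map_prod]
  refine Finset.prod_congr rfl fun ν _ => ?_
  exact vb_ofReal n (k ν) (p ν)

/-- `efZ` at a negative natural argument is a power of `w`: `e^{i(ζ+2πj)(−s)/n} = w_n(j;ζ)^s`. [folklore] -/
private theorem efZ_neg_natCast (n j s : ℕ) (ζ : ℂ) : efZ n j (-(s : ℤ)) ζ = w n j ζ ^ s := by
  unfold efZ w
  rw [← Complex.exp_nat_mul]
  congr 1
  push_cast
  ring

/-- one coordinate of the ū-twin: `Σ_{j<n} e^{−i(ζ+2πj)t/n} vb_n(j; ζ) = 1` for `t ∈ {0,…,n−1}`. [folklore] -/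
private theorem sum_efZ_neg_mul_vb (n : ℕ) (hn : n ≠ 0) (t : ℕ) (ht : t < n) (ζ : ℂ) :
    ∑ j ∈ Finset.range n, efZ n j (-(t : ℤ)) ζ * vb n j ζ = 1 := by
  have hn' : (n : ℂ) ≠ 0 := Nat.cast_ne_zero.mpr hn
  -- `e^{−i(ζ+2πj)t/n} · e^{i(ζ+2πj)s/n} = e^{iζ(s−t)/n} q^j`, `q = e^{2πi(s−t)/n}`
  have hterm : ∀ j s : ℕ, efZ n j (-(t : ℤ)) ζ * ef n j s ζ
      = cexp (I * ζ * ((s : ℂ) - t) / n) * cexp (2 * π * I * ((s : ℂ) - t) / n) ^ j := by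
    intro j s
    unfold ef efZ
    rw [← Complex.exp_nat_mul, ← Complex.exp_add, ← Complex.exp_add]
    congr 1
    push_cast
    field_simp
    ring
  have h : ∀ j ∈ Finset.range n, efZ n j (-(t : ℤ)) ζ * vb n j ζ
      = (n : ℂ)⁻¹ * ∑ s ∈ Finset.range n,
          cexp (I * ζ * ((s : ℂ) - t) / n) * cexp (2 * π * I * ((s : ℂ) - t) / n) ^ j := by
    intro j _
    unfold vb
    rw [mul_left_comm, Finset.mul_sum]
    congr 1
    refine Finset.sum_congr rfl fun s _ => ?_
    rw [hterm]
  rw [Finset.sum_congr rfl h, ← Finset.mul_sum, Finset.sum_comm]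
  simp_rw [← Finset.mul_sum]
  have h' : ∀ s ∈ Finset.range n,
      cexp (I * ζ * ((s : ℂ) - t) / n) * ∑ j ∈ Finset.range n, cexp (2 * π * I * ((s : ℂ) - t) / n) ^ j
        = if t = s then (n : ℂ) else 0 := by
    intro s hs
    rw [sum_rootOfUnity_pow n s t hn (Finset.mem_range.mp hs) ht]
    split_ifs with hst
    · subst hst; rw [sub_self, mul_zero, zero_div, Complex.exp_zero, one_mul]
    · rw [mul_zero]
  rw [Finset.sum_congr rfl h', Finset.sum_ite_eq (Finset.range n) t, if_pos (Finset.mem_range.mpr ht),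
    inv_mul_cancel₀ hn']

/-- one coordinate of the conjugate phase at a fine point: `e^{i(ζ+2πj)(−(nx+t))/n} = e^{−iζx} e^{−i(ζ+2πj)t/n}`. [folklore] -/
private theorem efZ_neg_fine (n j : ℕ) (hn : n ≠ 0) (x : ℤ) (t : ℕ) (ζ : ℂ) :
    efZ n j (-((n : ℤ) * x + (t : ℕ))) ζ = cexp (-(I * ζ * x)) * efZ n j (-(t : ℤ)) ζ := by
  unfold efZ
  have hn' : (n : ℂ) ≠ 0 := Nat.cast_ne_zero.mpr hn
  rw [← Complex.exp_add, show I * (ζ + 2 * π * j) * ((-((n : ℤ) * x + (t : ℕ)) : ℤ) : ℂ) / n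
      = -(I * ζ * x) + I * (ζ + 2 * π * j) * ((-(t : ℤ) : ℤ) : ℂ) / n + ((-(j * x) : ℤ) : ℂ) * (2 * π * I) by
        push_cast; field_simp; ring,
    Complex.exp_add, Complex.exp_int_mul_two_pi_mul_I, mul_one]

/-- the conjugate fibre phase is the plane wave of (2.43) at the fibre momentum:
`e^{−i(p′+2πk)·z/n} = PhZ n k (−z) p′`. [folklore] -/
private theorem cexp_neg_phaseC_shift (n : ℕ) (k : Fin d → Fin n) (z : Fin d → ℤ) (P : Fin d → ℂ) :
    cexp (-(I * phaseC (shift n k P) z / n)) = PhZ n k (-z) P := by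
  unfold PhZ efZ phaseC shift
  rw [← Complex.exp_sum]
  congr 1
  rw [Finset.mul_sum, Finset.sum_div, ← Finset.sum_neg_distrib]
  refine Finset.sum_congr rfl fun ν _ => ?_
  simp only [Pi.neg_apply]
  push_cast
  ring

/-- the series (2.43) of `φ` at a fibre momentum `p′ + 2πk`, termwise: `e^{−i(p′+l)·ξz}φ(z) = PhZ n k (−z) p′ · φ(z)`. [cite: Balaban1983RegularityDecay, (2.43) p.584] -/
theorem ftTerm_shift (n : ℕ) (φ : (Fin d → ℤ) → ℂ) (k : Fin d → Fin n) (P : Fin d → ℂ) (z : Fin d → ℤ) :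
    ftTerm n φ (shift n k P) z = PhZ n k (-z) P * φ z := by
  rw [ftTerm, cexp_neg_phaseC_shift]

/-- the modulus of the series terms does not see the shift: `|e^{−i(p′+2πk)·ξz}φ(z)| = |e^{−ip′·ξz}φ(z)|`
(`e^{−i2πk·z/n}` is a phase). [cite: Balaban1983RegularityDecay, (2.43) p.584] -/
theorem norm_ftTerm_shift (n : ℕ) (φ : (Fin d → ℤ) → ℂ) (k : Fin d → Fin n) (P : Fin d → ℂ) (z : Fin d → ℤ) :
    ‖ftTerm n φ (shift n k P) z‖ = ‖ftTerm n φ P z‖ := by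
  set r : ℝ := 2 * π * ∑ ν, ((k ν : ℕ) : ℝ) * (z ν : ℝ) with hr
  have h : phaseC (shift n k P) z = phaseC P z + (r : ℂ) := by
    unfold phaseC shift
    rw [hr]
    push_cast
    rw [Finset.mul_sum, ← Finset.sum_add_distrib]
    refine Finset.sum_congr rfl fun ν _ => ?_
    ring
  simp only [ftTerm, norm_mul]
  congr 1
  rw [h, show -(I * (phaseC P z + (r : ℂ)) / n) = -(I * phaseC P z / n) + ((-(r / n) : ℝ) : ℂ) * I by push_cast; ring,
    Complex.exp_add, norm_mul, Complex.norm_exp_ofReal_mul_I, mul_one]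

/-- convergence of the series (2.43) at `p′` gives it at every fibre point `p′ + 2πk`. [cite: Balaban1983RegularityDecay, (2.43) p.584] -/
theorem summable_ftTerm_shift (n : ℕ) {φ : (Fin d → ℤ) → ℂ} {P : Fin d → ℂ} (hφ : Summable (ftTerm n φ P))
    (k : Fin d → Fin n) : Summable (ftTerm n φ (shift n k P)) := by
  rw [← summable_norm_iff] at hφ ⊢
  simpa only [norm_ftTerm_shift] using hφ

/-- the conjugate phase at a fine point splits into the block phase and the offset phase:
`PhZ n k (−(ny + τ)) p′ = e^{−ip′·y} Π_ν e^{−i(p′_ν+2πk_ν)τ_ν/n}`. [folklore] -/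
private theorem PhZ_neg_finePt (n : ℕ) (hn : n ≠ 0) (k : Fin d → Fin n) (y : Fin d → ℤ) (τ : Fin d → Fin n) (P : Fin d → ℂ) :
    PhZ n k (-(finePt n y τ)) P
      = cexp (-(I * phaseC P y)) * ∏ ν, efZ n (k ν : ℕ) (-((τ ν : ℕ) : ℤ)) (P ν) := by
  unfold PhZ phaseC
  have h1 : ∀ ν, efZ n (k ν) ((-(finePt n y τ)) ν) (P ν)
      = cexp (-(I * P ν * y ν)) * efZ n (k ν : ℕ) (-((τ ν : ℕ) : ℤ)) (P ν) := by
    intro ν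
    rw [Pi.neg_apply, finePt, efZ_neg_fine n _ hn]
  simp_rw [h1]
  rw [Finset.prod_mul_distrib, Finset.mul_sum, ← Finset.sum_neg_distrib, Complex.exp_sum]
  congr 1
  refine Finset.prod_congr rfl fun ν _ => ?_
  congr 1
  ring

/-- **THE ū-TWIN OF `Q_jQ_j^* = 1`**: `Σ_k PhZ n k (−z) p′ · Vb n k p′ = e^{−ip′·⌊z/n⌋}`, i.e.
`Σ_{l′} e^{−i(p′+l′)·x} ū_j(p′+l′) = e^{−ip′·y(x)}` for every complex `p′` (the mirror image of `B4Green244.sum_PhZ_V`).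
[cite: Balaban1983RegularityDecay, (2.44)–(2.46) p.584] -/
theorem sum_PhZ_neg_Vb (n : ℕ) [NeZero n] (z : Fin d → ℤ) (P : Fin d → ℂ) :
    ∑ k : Fin d → Fin n, PhZ n k (-z) P * Vb n k P = cexp (-(I * phaseC P (coarse n z))) := by
  have hn : n ≠ 0 := NeZero.ne n
  conv_lhs => rw [← finePt_coarse_offset n z]
  have h0 : ∀ k : Fin d → Fin n, PhZ n k (-(finePt n (coarse n z) (offset n z))) P * Vb n k P
      = cexp (-(I * phaseC P (coarse n z)))
        * ∏ ν, efZ n (k ν : ℕ) (-((offset n z ν : ℕ) : ℤ)) (P ν) * vb n (k ν : ℕ) (P ν) := by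
    intro k
    rw [PhZ_neg_finePt n hn, Vb, mul_assoc, ← Finset.prod_mul_distrib]
  rw [Finset.sum_congr rfl (fun k _ => h0 k), ← Finset.mul_sum]
  have h := Finset.prod_univ_sum (fun _ : Fin d => (Finset.univ : Finset (Fin n)))
    (fun ν i => efZ n ((i : Fin n) : ℕ) (-((offset n z ν : ℕ) : ℤ)) (P ν) * vb n (i : ℕ) (P ν))
  rw [Fintype.piFinset_univ] at h
  rw [← h]
  have h1 : ∀ ν : Fin d, ∑ i : Fin n, efZ n ((i : Fin n) : ℕ) (-((offset n z ν : ℕ) : ℤ)) (P ν) * vb n (i : ℕ) (P ν)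
      = 1 := by
    intro ν
    rw [Fin.sum_univ_eq_sum_range (fun i => efZ n i (-((offset n z ν : ℕ) : ℤ)) (P ν) * vb n i (P ν)) n]
    exact sum_efZ_neg_mul_vb n hn _ (offset n z ν).isLt (P ν)
  simp_rw [h1]
  simp

/-! ### §4 The transform of a block-constant function and the aliasing identity -/

/-- the block sum of the conjugate fibre phases: `n^{−d} Σ_τ e^{−i(p′+2πk)·(ny+τ)/n} = e^{−ip′·y} u_j(p′+2πk)`
(`= e^{−ip′·y} V n k p′`; one geometric sum per coordinate, `B4StripSums.v`). [cite: Balaban1983RegularityDecay, (2.45) p.584, (2.47) p.585] -/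
theorem sum_PhZ_neg_finePt (n : ℕ) [NeZero n] (k : Fin d → Fin n) (y : Fin d → ℤ) (P : Fin d → ℂ) :
    ((n : ℂ) ^ d)⁻¹ * ∑ τ : Fin d → Fin n, PhZ n k (-(finePt n y τ)) P = cexp (-(I * phaseC P y)) * V n k P := by
  have hn : n ≠ 0 := NeZero.ne n
  simp_rw [PhZ_neg_finePt n hn]
  rw [← Finset.mul_sum, mul_left_comm]
  congr 1
  have h := Finset.prod_univ_sum (fun _ : Fin d => (Finset.univ : Finset (Fin n)))
    (fun ν i => efZ n (k ν : ℕ) (-(((i : Fin n) : ℕ) : ℤ)) (P ν))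
  rw [Fintype.piFinset_univ] at h
  rw [← h, show ((n : ℂ) ^ d)⁻¹ = ∏ _ν : Fin d, (n : ℂ)⁻¹ by
    rw [Finset.prod_const, Finset.card_univ, Fintype.card_fin, inv_pow], ← Finset.prod_mul_distrib]
  unfold V
  refine Finset.prod_congr rfl fun ν _ => ?_
  unfold v
  congr 1
  rw [Fin.sum_univ_eq_sum_range (fun i => efZ n (k ν : ℕ) (-((i : ℕ) : ℤ)) (P ν)) n]
  refine Finset.sum_congr rfl fun s _ => ?_
  exact efZ_neg_natCast n _ s _

/-- **p. 585: «f = Q_j^*g ⇒ f̃(p) = u_j(p) g̃(p′)»** — the transform of a BLOCK-CONSTANT function `x ↦ g(y(x))` at the fibre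
momentum `p = p′ + 2πk` is `u_j(p′+2πk) · g̃(p′)`: `ftSum n (g ∘ ⌊·/n⌋) (shift n k P) = V n k P · uft g P`, at every complex `p′` at
which the fine series of `g ∘ ⌊·/n⌋` converges. [cite: Balaban1983RegularityDecay, (2.47) p.585] -/
theorem ftSum_blockConst (n : ℕ) [NeZero n] {g : (Fin d → ℤ) → ℂ} (k : Fin d → Fin n) {P : Fin d → ℂ}
    (hg : Summable (ftTerm n (fun z => g (coarse n z)) P)) :
    ftSum n (fun z => g (coarse n z)) (shift n k P) = V n k P * uft g P := by
  have hn' : (n : ℂ) ≠ 0 := Nat.cast_ne_zero.mpr (NeZero.ne n)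
  have hs : Summable (ftTerm n (fun z => g (coarse n z)) (shift n k P)) := summable_ftTerm_shift n hg k
  rw [ftSum, tsum_eq_tsum_blocks n hs]
  simp_rw [ftTerm_shift, coarse_finePt]
  have h : ∀ y, ∑ τ : Fin d → Fin n, PhZ n k (-(finePt n y τ)) P * g y
      = (n : ℂ) ^ d * (V n k P * (cexp (-(I * phaseC P y)) * g y)) := by
    intro y
    rw [← Finset.sum_mul, ← mul_inv_cancel_left₀ (pow_ne_zero d hn') (∑ τ : Fin d → Fin n, PhZ n k (-(finePt n y τ)) P),
      sum_PhZ_neg_finePt n k y P]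
    ring
  simp_rw [h]
  rw [tsum_mul_left, tsum_mul_left, ← mul_assoc, inv_mul_cancel₀ (pow_ne_zero d hn'), one_mul, uft]

/-- the real part of the fine exponent: `Re(−ip′·z/n) = Σ_ν Im(p′_ν) z_ν/n`. [folklore] -/
private theorem re_neg_phaseC_div (n : ℕ) (P : Fin d → ℂ) (z : Fin d → ℤ) :
    (-(I * phaseC P z / n)).re = ∑ ν, (P ν).im * ((z ν : ℝ) / n) := by
  rw [Complex.neg_re, Complex.div_natCast_re, Complex.mul_re, Complex.I_re, Complex.I_im, zero_mul, one_mul, zero_sub,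
    neg_div, neg_neg]
  unfold phaseC
  rw [Complex.im_sum, Finset.sum_div]
  refine Finset.sum_congr rfl fun ν _ => ?_
  simp only [Complex.mul_im, Complex.intCast_re, Complex.intCast_im, mul_zero, zero_add]
  ring

/-- the real part of the block exponent: `Re(−ip′·y) = Σ_ν Im(p′_ν) y_ν`. [folklore] -/
private theorem re_neg_phaseC (P : Fin d → ℂ) (y : Fin d → ℤ) : (-(I * phaseC P y)).re = ∑ ν, (P ν).im * (y ν : ℝ) := by
  rw [Complex.neg_re, Complex.mul_re, Complex.I_re, Complex.I_im, zero_mul, one_mul, zero_sub, neg_neg]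
  unfold phaseC
  rw [Complex.im_sum]
  refine Finset.sum_congr rfl fun ν _ => ?_
  simp only [Complex.mul_im, Complex.intCast_re, Complex.intCast_im, mul_zero, zero_add]

/-- within a block the real parts of the fine and the block exponent differ by at most `Σ_ν |Im p′_ν|`
(`z/n − ⌊z/n⌋ ∈ [0,1)^d`). [folklore] -/
private theorem abs_re_fine_sub_re_coarse_le (n : ℕ) [NeZero n] (P : Fin d → ℂ) (z : Fin d → ℤ) :
    |(-(I * phaseC P z / n)).re - (-(I * phaseC P (coarse n z))).re| ≤ ∑ ν, |(P ν).im| := by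
  have hn : n ≠ 0 := NeZero.ne n
  have hnr : (0 : ℝ) < n := by exact_mod_cast Nat.pos_of_ne_zero hn
  rw [re_neg_phaseC_div, re_neg_phaseC, ← Finset.sum_sub_distrib]
  refine (Finset.abs_sum_le_sum_abs _ _).trans (Finset.sum_le_sum fun ν _ => ?_)
  rw [← mul_sub, abs_mul]
  have hc0 : (coarse n z ν : ℝ) ≤ (z ν : ℝ) / n := by
    rw [le_div_iff₀ hnr]
    have : (coarse n z ν : ℤ) * n ≤ z ν := by
      simp only [coarse]; exact Int.ediv_mul_le _ (by exact_mod_cast hn)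
    exact_mod_cast this
  have hc1 : (z ν : ℝ) / n < (coarse n z ν : ℝ) + 1 := by
    rw [div_lt_iff₀ hnr]
    have : z ν < ((coarse n z ν : ℤ) + 1) * n := by
      simp only [coarse]; exact Int.lt_ediv_add_one_mul_self _ (by exact_mod_cast Nat.pos_of_ne_zero hn)
    have := (Int.cast_lt (R := ℝ)).mpr this
    push_cast at this
    linarith
  have h01 : |(z ν : ℝ) / n - (coarse n z ν : ℝ)| ≤ 1 := by
    rw [abs_le]; constructor <;> linarith
  calc |(P ν).im| * |(z ν : ℝ) / n - (coarse n z ν : ℝ)| ≤ |(P ν).im| * 1 := by gcongr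
    _ = |(P ν).im| := mul_one _

/-- the block phase is comparable with the fine plane wave: `|e^{−ip′·⌊z/n⌋}| ≤ e^{Σ_ν|Im p′_ν|} · |e^{−ip′·z/n}|`. [folklore] -/
private theorem norm_cexp_coarse_le (n : ℕ) [NeZero n] (P : Fin d → ℂ) (z : Fin d → ℤ) :
    ‖cexp (-(I * phaseC P (coarse n z)))‖ ≤ Real.exp (∑ ν, |(P ν).im|) * ‖cexp (-(I * phaseC P z / n))‖ := by
  rw [Complex.norm_exp, Complex.norm_exp, ← Real.exp_add]
  apply Real.exp_le_exp.mpr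
  have h := abs_re_fine_sub_re_coarse_le n P z
  rw [abs_le] at h
  linarith [h.1]

/-- conversely `|e^{−ip′·z/n}| ≤ e^{Σ_ν|Im p′_ν|} · |e^{−ip′·⌊z/n⌋}|`. [folklore] -/
private theorem norm_cexp_fine_le (n : ℕ) [NeZero n] (P : Fin d → ℂ) (z : Fin d → ℤ) :
    ‖cexp (-(I * phaseC P z / n))‖ ≤ Real.exp (∑ ν, |(P ν).im|) * ‖cexp (-(I * phaseC P (coarse n z)))‖ := by
  rw [Complex.norm_exp, Complex.norm_exp, ← Real.exp_add]
  apply Real.exp_le_exp.mpr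
  have h := abs_re_fine_sub_re_coarse_le n P z
  rw [abs_le] at h
  linarith [h.2]

/-- the block-phase series `Σ_z e^{−ip′·⌊z/n⌋} φ(z)` converges where the fine series (2.43) of `φ` does. [folklore] -/
private theorem summable_cexp_coarse_mul (n : ℕ) [NeZero n] {φ : (Fin d → ℤ) → ℂ} {P : Fin d → ℂ} (hφ : Summable (ftTerm n φ P)) :
    Summable fun z => cexp (-(I * phaseC P (coarse n z))) * φ z := by
  rw [← summable_norm_iff] at hφ
  refine Summable.of_norm_bounded (hφ.mul_left (Real.exp (∑ ν, |(P ν).im|))) fun z => ?_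
  rw [norm_mul, ftTerm, norm_mul, ← mul_assoc]
  exact mul_le_mul_of_nonneg_right (norm_cexp_coarse_le n P z) (norm_nonneg _)

/-- **THE ALIASING IDENTITY OF THE BLOCK AVERAGE**: `(Q_jφ)~(p′) = Σ_{l′} ū_j(p′+l′) φ̃(p′+l′)` — the unit-lattice transform of
`Q_jφ` is the `ū`-weighted sum of the fine transform over the fibre `p′ + 2πk′`, `k′ ∈ {0,…,n−1}^d`; at every complex `p′` at
which the series (2.43) of `φ` converges. [cite: Balaban1983RegularityDecay, (2.45) p.584] -/
theorem uft_Qavg (n : ℕ) [NeZero n] {φ : (Fin d → ℤ) → ℂ} {P : Fin d → ℂ} (hφ : Summable (ftTerm n φ P)) :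
    uft (Qavg n φ) P = ∑ k : Fin d → Fin n, Vb n k P * ftSum n φ (shift n k P) := by
  -- both sides equal `n^{−d} Σ'_z e^{−ip′·⌊z/n⌋} φ(z)`
  have hG := summable_cexp_coarse_mul n hφ
  have hL : uft (Qavg n φ) P = ((n : ℂ) ^ d)⁻¹ * ∑' z, cexp (-(I * phaseC P (coarse n z))) * φ z := by
    rw [tsum_eq_tsum_blocks n hG, uft, ← tsum_mul_left]
    refine tsum_congr fun y => ?_
    simp_rw [coarse_finePt]
    rw [Qavg, ← Finset.mul_sum]
    ring
  have hR : ∑ k : Fin d → Fin n, Vb n k P * ftSum n φ (shift n k P)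
      = ((n : ℂ) ^ d)⁻¹ * ∑' z, cexp (-(I * phaseC P (coarse n z))) * φ z := by
    have h1 : ∀ k : Fin d → Fin n, Vb n k P * ftSum n φ (shift n k P)
        = ((n : ℂ) ^ d)⁻¹ * ∑' z, Vb n k P * (PhZ n k (-z) P * φ z) := by
      intro k
      rw [ftSum, tsum_mul_left]
      simp_rw [ftTerm_shift]
      ring
    simp_rw [h1]
    rw [← Finset.mul_sum]
    congr 1
    rw [← Summable.tsum_finsetSum (fun k _ => ((summable_ftTerm_shift n hφ k).mul_left (Vb n k P)).congr
      (fun z => by rw [ftTerm_shift]))]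
    refine tsum_congr fun z => ?_
    rw [← sum_PhZ_neg_Vb n z P, Finset.sum_mul]
    refine Finset.sum_congr rfl fun k _ => ?_
    ring
  rw [hL, hR]

/-- the fine series (2.43) of `Q_j^*Q_jφ` converges where that of `φ` does. [cite: Balaban1983RegularityDecay, (2.44)–(2.45) p.584] -/
theorem summable_ftTerm_blockAvg (n : ℕ) [NeZero n] {φ : (Fin d → ℤ) → ℂ} {P : Fin d → ℂ}
    (hφ : Summable (ftTerm n φ P)) : Summable (ftTerm n (blockAvg n φ) P) := by
  have hn : n ≠ 0 := NeZero.ne n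
  have hnr : (0 : ℝ) < n := by exact_mod_cast Nat.pos_of_ne_zero hn
  set C : ℝ := Real.exp (∑ ν, |(P ν).im|) with hC
  -- the block sums of `|ftTerm φ|`
  set H : (Fin d → ℤ) → ℝ := fun y => ∑ τ : Fin d → Fin n, ‖ftTerm n φ P (finePt n y τ)‖ with hH
  have hφn : Summable fun z => ‖ftTerm n φ P z‖ := summable_norm_iff.mpr hφ
  -- `H` is summable over the block labels
  have hHs : Summable H := by
    have h1 : Summable ((fun z => ‖ftTerm n φ P z‖) ∘ blockEquiv n) := (blockEquiv n).summable_iff.mpr hφn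
    have h2 := ((summable_prod_of_nonneg (fun _ => norm_nonneg _)).mp h1).2
    refine h2.congr fun y => ?_
    rw [tsum_fintype]
    rfl
  -- hence `z ↦ H(⌊z/n⌋)` is summable over the fine lattice (each value repeated `n^d` times)
  have hHc : Summable fun z => H (coarse n z) := by
    rw [← (blockEquiv n).summable_iff]
    have h3 : (fun z => H (coarse n z)) ∘ blockEquiv n = fun yτ : (Fin d → ℤ) × (Fin d → Fin n) => H yτ.1 := by
      funext yτ
      simp only [Function.comp, blockEquiv, Equiv.coe_fn_mk, coarse_finePt]
    rw [h3]
    refine (summable_prod_of_nonneg (fun yτ => ?_)).mpr ⟨fun y => ?_, ?_⟩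
    · exact Finset.sum_nonneg fun _ _ => norm_nonneg _
    · exact (hasSum_fintype _).summable
    · simp_rw [tsum_fintype, Finset.sum_const, Finset.card_univ, nsmul_eq_mul]
      exact hHs.mul_left _
  -- comparison within a block: `|e^{−ip′·z/n}| ≤ C·|e^{−ip′·z′/n}|` for `z, z′` in the same block
  have hC0 : 0 ≤ C := (Real.exp_pos _).le
  have hcmp : ∀ z (τ : Fin d → Fin n), ‖cexp (-(I * phaseC P z / n))‖
      ≤ C * C * ‖cexp (-(I * phaseC P (finePt n (coarse n z) τ) / n))‖ := by
    intro z τ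
    have h1 := norm_cexp_fine_le n P z
    have h2 := norm_cexp_coarse_le n P (finePt n (coarse n z) τ)
    rw [coarse_finePt] at h2
    calc ‖cexp (-(I * phaseC P z / n))‖ ≤ C * ‖cexp (-(I * phaseC P (coarse n z)))‖ := h1
      _ ≤ C * (C * ‖cexp (-(I * phaseC P (finePt n (coarse n z) τ) / n))‖) := by gcongr
      _ = C * C * ‖cexp (-(I * phaseC P (finePt n (coarse n z) τ) / n))‖ := by ring
  refine Summable.of_norm_bounded ((hHc.mul_left (C * C * ((n : ℝ) ^ d)⁻¹))) fun z => ?_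
  rw [ftTerm, blockAvg, norm_mul, norm_mul, norm_inv, norm_pow, Complex.norm_natCast, hH]
  simp only
  calc ‖cexp (-(I * phaseC P z / n))‖ * (((n : ℝ) ^ d)⁻¹ * ‖∑ τ : Fin d → Fin n, φ (finePt n (coarse n z) τ)‖)
      ≤ ‖cexp (-(I * phaseC P z / n))‖ * (((n : ℝ) ^ d)⁻¹ * ∑ τ : Fin d → Fin n, ‖φ (finePt n (coarse n z) τ)‖) := by
        gcongr; exact norm_sum_le _ _
    _ = ((n : ℝ) ^ d)⁻¹ * ∑ τ : Fin d → Fin n, ‖cexp (-(I * phaseC P z / n))‖ * ‖φ (finePt n (coarse n z) τ)‖ := by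
        rw [Finset.mul_sum, Finset.mul_sum, Finset.mul_sum]
        refine Finset.sum_congr rfl fun τ _ => ?_; ring
    _ ≤ ((n : ℝ) ^ d)⁻¹ * ∑ τ : Fin d → Fin n,
          (C * C * ‖cexp (-(I * phaseC P (finePt n (coarse n z) τ) / n))‖) * ‖φ (finePt n (coarse n z) τ)‖ := by
        gcongr with τ _
        exact hcmp z τ
    _ = C * C * ((n : ℝ) ^ d)⁻¹ * ∑ τ : Fin d → Fin n, ‖ftTerm n φ P (finePt n (coarse n z) τ)‖ := by
        rw [Finset.mul_sum, Finset.mul_sum]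
        refine Finset.sum_congr rfl fun τ _ => ?_
        rw [ftTerm, norm_mul]; ring

/-- **THE SECOND SUMMAND OF (2.45)**: `(Q_j^*Q_jφ)~(p′+2πk) = u_j(p′+2πk) Σ_{k′} ū_j(p′+2πk′) φ̃(p′+2πk′)` — the transform of
the block-averaging projection `B4Green244.blockAvg n = Q_j^*Q_j` at a fibre momentum, at every complex `p′` at which the
series (2.43) of `φ` converges. [cite: Balaban1983RegularityDecay, (2.45) p.584] -/
theorem ftSum_blockAvg (n : ℕ) [NeZero n] {φ : (Fin d → ℤ) → ℂ} {P : Fin d → ℂ} (hφ : Summable (ftTerm n φ P))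
    (k : Fin d → Fin n) :
    ftSum n (blockAvg n φ) (shift n k P) = V n k P * ∑ k' : Fin d → Fin n, Vb n k' P * ftSum n φ (shift n k' P) := by
  have hQ : Summable (ftTerm n (fun z => Qavg n φ (coarse n z)) P) := summable_ftTerm_blockAvg n hφ
  exact (ftSum_blockConst n k hQ).trans (by rw [uft_Qavg n hφ])

/-! ### §5 (2.44) ⇒ (2.45) -/

/-- **(2.44) ⇒ (2.45), AT A COMPLEX REDUCED MOMENTUM.**  If `(−Δ^ξ + m² + aQ_j^*Q_j)φ₀ = f` on the fine lattice `ξℤ^d`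
(`B4Green244.opD n a m²`) and the series (2.43) of `φ₀` converges at `p′`, then for every shift `l = 2πk`:
`Δ^ξ(p′+l) φ̃₀(p′+l) + a u_j(p′+l) Σ_{l′} ū_j(p′+l′) φ̃₀(p′+l′) = f̃(p′+l)`.
[cite: Balaban1983RegularityDecay, (2.44)–(2.45) p.584] -/
theorem eq245_of_eq244 (n : ℕ) [NeZero n] (a m2 : ℝ) {φ₀ f : (Fin d → ℤ) → ℂ} {P : Fin d → ℂ}
    (hφ : Summable (ftTerm n φ₀ P)) (h : ∀ z, opD n a m2 φ₀ z = f z) (k : Fin d → Fin n) :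
    DeltaXi n m2 (shift n k P) * ftSum n φ₀ (shift n k P)
        + a * V n k P * ∑ k' : Fin d → Fin n, Vb n k' P * ftSum n φ₀ (shift n k' P)
      = ftSum n f (shift n k P) := by
  have hf : f = fun z => (negLap n φ₀ z + m2 * φ₀ z) + a * blockAvg n φ₀ z := by
    funext z; rw [← h z]; rfl
  have hk : Summable (ftTerm n φ₀ (shift n k P)) := summable_ftTerm_shift n hφ k
  have h1 : Summable (ftTerm n (fun z => negLap n φ₀ z + m2 * φ₀ z) (shift n k P)) :=
    summable_ftTerm_add n (summable_ftTerm_negLap n hk) (summable_ftTerm_const_mul n _ hk)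
  have h2 : Summable (ftTerm n (fun z => (a : ℂ) * blockAvg n φ₀ z) (shift n k P)) :=
    summable_ftTerm_const_mul n _ (summable_ftTerm_shift n (summable_ftTerm_blockAvg n hφ) k)
  rw [hf, ftSum_add n h1 h2, ftSum_negLap_add_mass n m2 hk, ftSum_const_mul, ftSum_blockAvg n hφ k]
  ring

/-- **(2.44) ⇒ (2.45) AS PRINTED** (real reduced momentum `p′`, `φ₀ ∈ ℓ¹(ℤ^d)`, the conjugate `\overline{u_j(p′+l′)}`):
if `(−Δ^ξ + m² + aQ_j^*Q_j)φ₀ = f` on `ξℤ^d` with `Σ_z|φ₀(z)| < ∞`, then for every `p′ ∈ ℝ^d` and every shift `l = 2πk`,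
`Δ^ξ(p′+l)φ̃₀(p′+l) + a u_j(p′+l) Σ_{l′} \overline{u_j(p′+l′)} φ̃₀(p′+l′) = f̃(p′+l)` — literally the fibre hypothesis
`Δ k·φ k + a·u k·Σ_{k′} conj(u k′)·φ k′ = f k` of `B4Eq246Fibre.sol246_unique` with `Δ k = DeltaXi n m² (shift n k p′)`,
`u k = V n k p′`, `φ k = ftSum n φ₀ (shift n k p′)`, `f k = ftSum n f (shift n k p′)`. [cite: Balaban1983RegularityDecay, (2.44)–(2.45) p.584] -/
theorem eq245_of_eq244_real (n : ℕ) [NeZero n] (a m2 : ℝ) {φ₀ f : (Fin d → ℤ) → ℂ}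
    (hφ : Summable fun z => ‖φ₀ z‖) (h : ∀ z, opD n a m2 φ₀ z = f z) (p : Fin d → ℝ) (k : Fin d → Fin n) :
    DeltaXi n m2 (shift n k (ofRealVec p)) * ftSum n φ₀ (shift n k (ofRealVec p))
        + a * V n k (ofRealVec p) * ∑ k' : Fin d → Fin n,
            conj (V n k' (ofRealVec p)) * ftSum n φ₀ (shift n k' (ofRealVec p))
      = ftSum n f (shift n k (ofRealVec p)) := by
  simp_rw [← Vb_ofRealVec]
  exact eq245_of_eq244 n a m2 (summable_ftTerm_ofRealVec n hφ p) h k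

end

end Literature.MathematicalPhysics.QuantumFieldTheory.Balaban1983to89.B4Eq245Aliasing
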